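import Summits.QuantumFields.BalabanUV.T4Continuum.Support.NE7EJBracketForms
import Summits.QuantumFields.BalabanUV.T4Continuum.Support.NE7EJBracketIntegral

/-!
# NE7EJBracketPath — row NE7 (node U5), candidate route HOM, variant H1L-EJ: THE τ-LINE OF QUADRATIC ACTIONS `K_τ = K₀ + τE` —
# OPERATOR CONCAVITY OF THE VALUE FORM, THE EXACT (E4) EXPANSION WITH ITS REMAINDER `q` NAMED AND BOUNDED, HELLMANN–FEYNMAN
# (`g′(τ) = 𝔇(U_τ)` as a `HasDerivWithinAt`), AND (E1) ∕ (E3) FOR FORMS BY FILES 106 ∕ 107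

Lineage `b2b-balaban-t4-ne7-p2` (CRUX PROVER NE7 #2 = C-HOM°'s kernel hand), generation 80; file 109 (after 106 `NE7EJBracket`, 107
`NE7EJBracketIntegral`, 108 `NE7EJBracketForms`).  CONSUMER SHAPES (by name): lens 2's S-91-1 (`t4/ideate/NE7/lens2-g91/ENVELOPE-SUPPLY.md` §2:
«Differentiate the critical-point equation … ∂_τU_τ = −H_τ^{−1} P d𝔇(U_τ) … (E4) g″(τ) = −q(τ), q := ⟨P d𝔇(U_τ), H_τ^{−1} P d𝔇(U_τ)⟩ …
(E4a) R₂ = ∫₀¹(1−τ)q … §3 (iii) … F″(s) = −Var ↦ g″ = −q ≤ 0») and lens 1's (E1)∕(E3) (`lens1-g58/DEFECT-NOTE.md` §2), for HOM's line F3 at the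
quadratic level: `A_τ = qf (K₀ + τE)` on the fibre `{Q A = B}`, `U_τ B = H_τ B := minMap (K₀ + τE) Q B`, `g(τ) = ⟨B, P_τ⁻¹ B⟩`.

WHAT IS PROVED ([folklore]; `K₀ ≻ 0`, `K₀ + E ≻ 0`, `Q` with independent rows; `E` of any sign):
* §1 `lineK K₀ E τ = K₀ + τ•E` (`_zero ∕ _one ∕ _sub ∕ _convex`), **`lineK_posDef`** on `[0,1]`, `qf_lineK`, `lineF_qf` (file 106's `lineF` of the
  two quadratic actions IS the quadratic action of `K_τ`).
* §2 the selection `lineMin … τ = H_τ B` and the value `lineValue … τ = ⟨B, P_τ⁻¹B⟩`: `lineMin_mem ∕ lineMin_isMinOn` (file 108), `lineVal_eq`;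
  hence BY FILES 106 ∕ 107: **`concaveOn_lineValue`** ((E3): `τ ↦ ⟨B, P_τ⁻¹B⟩` concave on `[0,1]`), **`defectForm_antitoneOn`** (`τ ↦ ⟨H_τB, E H_τB⟩`
  non-increasing), **`lineValue_one_sub_zero_eq_integral`** ((E1): `⟨B,(P₁⁻¹ − P₀⁻¹)B⟩ = ∫₀¹ ⟨H_τB, E H_τB⟩ dτ`).
* §3 **OPERATOR CONCAVITY** (Ando-type, by the variational characterisation, no spectral theory): `value_concave_qf` and
  **`blockPropInv_concave`** — `(Q(aK₀ + bK₁)⁻¹Qᵀ)⁻¹ − (a(QK₀⁻¹Qᵀ)⁻¹ + b(QK₁⁻¹Qᵀ)⁻¹) ⪰ 0` for `a, b ≥ 0`, `a + b = 1`, any two positive forms.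
* §4 **THE EXACT (E4) EXPANSION**: `qrem … τ σ = ⟨E H_τB, G_σ (E H_τB)⟩` and **`lineValue_expand`** — for all `τ, σ ∈ [0,1]`,
  `g(σ) = g(τ) + (σ−τ)·⟨H_τB, EH_τB⟩ − (σ−τ)²·q(τ,σ)` (file 108's (E2) at the pair `(K_τ, K_σ)`: the remainder between ANY two parameters is
  `(σ−τ)²` times a constrained-propagator form — lens 2's (E4a) in finite form, `R₂(τ→σ) = (σ−τ)² q(τ,σ)`, `remainder_two_points`);
  `qrem_nonneg`; the INVERSE IS OPERATOR-CONVEX along the segment, again variationally: `two_mul_dot_sub_qf_le_inv_form` (`2⟨x,y⟩ − ⟨y,Ky⟩ ≤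
  ⟨x,K⁻¹x⟩`), `inv_form_eq_sup` (equality at `y = K⁻¹x`), **`inv_lineK_form_le`** (`⟨x,K_σ⁻¹x⟩ ≤ (1−σ)⟨x,K₀⁻¹x⟩ + σ⟨x,K₁⁻¹x⟩`), whence
  `qrem_le_const` (`q(τ,σ) ≤ ⟨x,K₀⁻¹x⟩ + ⟨x,K₁⁻¹x⟩`, `x = EH_τB`, UNIFORMLY in `σ`).
* §5 **HELLMANN–FEYNMAN** `hasDerivWithinAt_lineValue`: `g` has derivative `⟨H_τB, E H_τB⟩ = 𝔇(U_τ)` within `[0,1]` at every `τ ∈ [0,1]` — the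
  first-order envelope statement «g′(τ) = 𝔇(U_τ)» of (E1), here a THEOREM (slope − 𝔇(U_τ) = −(σ−τ)q(τ,σ), bounded by §4).

HONEST FRAMING: [folklore] (constrained quadratic minimisation; concavity of a minimum; operator convexity of the inverse by completing the
square); REAL forms; the infinitesimal second-order form «g″(τ) = −q(τ)» (which needs continuity of `σ ↦ G_σ`) is NOT typed — its EXACT
finite form `lineValue_expand` is; (H-inv) is the hypothesis `K₀ ≻ 0 ∧ K₀ + E ≻ 0` (real slice; nothing complex); nothing of Bałaban's
operators instantiated (an1's dictionary); NOT (N1) ∕ (N1′) ∕ (N1-δ) ∕ EJ-1c ∕ EJ-2 ∕ EJ-3 ∕ K1-var(s); NOT a letter move (the desk prices tag (IV),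
ask A-91-1); credit (E4) lens 2 g91, (E1)∕(E3) lens 1 g58.  NE7 NOT PRINTED ∕ NOT PROVED; spine 0∕9; FIXED FINITE T⁴, rung (B)+1; NOT infinite
volume, NOT mass gap, NOT Clay.  HONEST DEPENDENCY: continuum YM on T⁴ ⇐ BetaPertH ∧ nine spine estimates (0/9 proved); BetaPertH ⇐ (D1) ∧
(D4) ∧ CAP+tail; G-an2-4 gates asym, D1 and NE2/3/4.
-/

noncomputable section

open Matrix Set MeasureTheory intervalIntegral Filter Topology

namespace Summit.QuantumFields.BalabanUV.T4Continuum.NE7EJBracketPath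

open Literature.MathematicalPhysics.QuantumFieldTheory.Balaban1983to89.Beta.Composition (blockProp)
open Literature.MathematicalPhysics.QuantumFieldTheory.Balaban1983to89.Beta.Envelope
open NE7EJBracket NE7EJBracketIntegral NE7EJBracketForms

variable {ν μ : Type*} [Fintype ν] [Fintype μ] [DecidableEq ν] [DecidableEq μ]

/-! ### §1 The line of forms `K_τ = K₀ + τE` -/

section LineOfForms

/-- the τ-LINE OF FORMS `K_τ := K₀ + τ•E` (`K₁ = K₀ + E`; HOM's F3 `(1−τ)A_c + τA_B` at the quadratic level). [folklore] -/
def lineK (K₀ E : Matrix ν ν ℝ) (τ : ℝ) : Matrix ν ν ℝ := K₀ + τ • E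

variable (K₀ E : Matrix ν ν ℝ)

omit [Fintype ν] [Fintype μ] [DecidableEq ν] [DecidableEq μ] in
/-- unfolding. [folklore] -/
@[simp] theorem lineK_apply (τ : ℝ) : lineK K₀ E τ = K₀ + τ • E := rfl

omit [Fintype ν] [Fintype μ] [DecidableEq ν] [DecidableEq μ] in
/-- `K_0 = K₀`. [folklore] -/
theorem lineK_zero : lineK K₀ E 0 = K₀ := by simp

omit [Fintype ν] [Fintype μ] [DecidableEq ν] [DecidableEq μ] in
/-- `K_1 = K₀ + E`. [folklore] -/
theorem lineK_one : lineK K₀ E 1 = K₀ + E := by simp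

omit [Fintype ν] [Fintype μ] [DecidableEq ν] [DecidableEq μ] in
/-- `K_σ − K_τ = (σ − τ)•E`. [folklore] -/
theorem lineK_sub (σ τ : ℝ) : lineK K₀ E σ - lineK K₀ E τ = (σ - τ) • E := by
  simp only [lineK_apply, sub_smul]; abel

omit [Fintype ν] [Fintype μ] [DecidableEq ν] [DecidableEq μ] in
/-- `K_τ = (1−τ)•K₀ + τ•(K₀ + E)`. [folklore] -/
theorem lineK_convex (τ : ℝ) : lineK K₀ E τ = (1 - τ) • K₀ + τ • (K₀ + E) := by
  simp only [lineK_apply, sub_smul, one_smul, smul_add]; abel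

variable {K₀ E}

omit [Fintype ν] [Fintype μ] [DecidableEq ν] [DecidableEq μ] in
/-- **positivity along the segment**: `K₀ ≻ 0` and `K₀ + E ≻ 0` ⇒ `K_τ ≻ 0` for `τ ∈ [0,1]`. [folklore] -/
theorem lineK_posDef (h0 : K₀.PosDef) (h1 : (K₀ + E).PosDef) {τ : ℝ} (hτ : τ ∈ Icc (0:ℝ) 1) : (lineK K₀ E τ).PosDef := by
  rcases eq_or_lt_of_le hτ.1 with h | h
  · rw [← h, lineK_zero]; exact h0
  · rw [lineK_convex]
    exact Matrix.PosDef.posSemidef_add (h0.posSemidef.smul (sub_nonneg.mpr hτ.2)) (h1.smul h)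

omit [Fintype μ] [DecidableEq ν] [DecidableEq μ] in
/-- `qf K_τ A = qf K₀ A + τ·qf E A`. [folklore] -/
theorem qf_lineK (τ : ℝ) (A : ν → ℝ) : qf (lineK K₀ E τ) A = qf K₀ A + τ * qf E A := by
  rw [lineK_apply, qf_add_form, qf_smul_form]

omit [Fintype μ] [DecidableEq ν] [DecidableEq μ] in
/-- file 106's line of the two quadratic actions IS the quadratic action of the line of forms: `lineF (qf K₀) (qf (K₀+E)) τ = qf K_τ`.
[folklore] -/
theorem lineF_qf (τ : ℝ) : lineF (qf K₀) (qf (K₀ + E)) τ = qf (lineK K₀ E τ) := by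
  funext A
  rw [lineF_apply, qf_sub, add_sub_cancel_left, qf_lineK]

omit [Fintype μ] [DecidableEq ν] [DecidableEq μ] in
/-- the defect of the two endpoint actions is `qf E`. [folklore] -/
theorem defect_qf_line : defect (qf K₀) (qf (K₀ + E)) = qf E := by
  rw [defect_qf, add_sub_cancel_left]

end LineOfForms

/-! ### §2 The minimiser selection along the line; (E3) and (E1) for forms by files 106 ∕ 107 -/

section Selection

/-- THE MINIMISER SELECTION along the line: `U_τ B := H(K_τ) B = minMap (K₀ + τE) Q B`. [folklore] -/
def lineMin (K₀ E : Matrix ν ν ℝ) (Q : Matrix μ ν ℝ) (B : μ → ℝ) (τ : ℝ) : ν → ℝ := minMap (lineK K₀ E τ) Q *ᵥ B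

/-- THE VALUE along the line: `g(τ) := ⟨B, P_τ⁻¹ B⟩`, `P_τ = Q K_τ⁻¹ Qᵀ`. [folklore] -/
def lineValue (K₀ E : Matrix ν ν ℝ) (Q : Matrix μ ν ℝ) (B : μ → ℝ) (τ : ℝ) : ℝ := B ⬝ᵥ ((blockProp (lineK K₀ E τ) Q)⁻¹ *ᵥ B)

variable {K₀ E : Matrix ν ν ℝ} {Q : Matrix μ ν ℝ}

/-- unfolding. [folklore] -/
@[simp] theorem lineMin_apply (B : μ → ℝ) (τ : ℝ) : lineMin K₀ E Q B τ = minMap (lineK K₀ E τ) Q *ᵥ B := rfl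

/-- unfolding. [folklore] -/
@[simp] theorem lineValue_apply (B : μ → ℝ) (τ : ℝ) : lineValue K₀ E Q B τ = B ⬝ᵥ ((blockProp (lineK K₀ E τ) Q)⁻¹ *ᵥ B) := rfl

/-- the selection stays on the fibre. [folklore] -/
theorem lineMin_mem (h0 : K₀.PosDef) (h1 : (K₀ + E).PosDef) (hQ : Function.Injective Q.vecMul) (B : μ → ℝ) :
    ∀ τ ∈ Icc (0:ℝ) 1, lineMin K₀ E Q B τ ∈ fibre Q B := fun _ hτ =>
  minMap_mulVec_mem_fibre (lineK_posDef h0 h1 hτ) hQ B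

/-- the selection MINIMISES `A_τ` on the fibre for every `τ ∈ [0,1]` (file 108's `isMinOn_qf_minMap` along the line). [folklore] -/
theorem lineMin_isMinOn (h0 : K₀.PosDef) (h1 : (K₀ + E).PosDef) (hQ : Function.Injective Q.vecMul) (B : μ → ℝ) :
    ∀ τ ∈ Icc (0:ℝ) 1, IsMinOn (lineF (qf K₀) (qf (K₀ + E)) τ) (fibre Q B) (lineMin K₀ E Q B τ) := fun τ hτ => by
  rw [lineF_qf]
  exact isMinOn_qf_minMap (lineK_posDef h0 h1 hτ) hQ B

/-- file 106's value along this selection is `⟨B, P_τ⁻¹B⟩` on `[0,1]`. [folklore] -/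
theorem lineVal_eq (h0 : K₀.PosDef) (h1 : (K₀ + E).PosDef) (hQ : Function.Injective Q.vecMul) (B : μ → ℝ) {τ : ℝ}
    (hτ : τ ∈ Icc (0:ℝ) 1) : lineVal (qf K₀) (qf (K₀ + E)) (lineMin K₀ E Q B) τ = lineValue K₀ E Q B τ := by
  rw [lineVal_apply, lineF_qf, lineMin_apply, qf_minMap (lineK_posDef h0 h1 hτ) hQ, lineValue_apply]

/-- **(E3) FOR FORMS**: `τ ↦ ⟨B, P_τ⁻¹ B⟩` is CONCAVE on `[0,1]` (file 106's `concaveOn_lineVal`). [folklore] -/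
theorem concaveOn_lineValue (h0 : K₀.PosDef) (h1 : (K₀ + E).PosDef) (hQ : Function.Injective Q.vecMul) (B : μ → ℝ) :
    ConcaveOn ℝ (Icc (0:ℝ) 1) (lineValue K₀ E Q B) :=
  (concaveOn_lineVal (convex_Icc 0 1) (lineMin_mem h0 h1 hQ B) (lineMin_isMinOn h0 h1 hQ B)).congr fun _ hτ =>
    lineVal_eq h0 h1 hQ B hτ

/-- **ANTITONE DEFECT FORM**: `τ ↦ ⟨H_τB, E H_τB⟩` is non-increasing on `[0,1]` (file 106's `defect_antitoneOn`). [folklore] -/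
theorem defectForm_antitoneOn (h0 : K₀.PosDef) (h1 : (K₀ + E).PosDef) (hQ : Function.Injective Q.vecMul) (B : μ → ℝ) :
    AntitoneOn (fun τ => qf E (lineMin K₀ E Q B τ)) (Icc (0:ℝ) 1) := by
  have h := defect_antitoneOn (lineMin_mem h0 h1 hQ B) (lineMin_isMinOn h0 h1 hQ B)
  rwa [defect_qf_line] at h

/-- the bracket along the line is the value-form difference of the endpoints. [folklore] -/
theorem lineValue_one_sub_zero (B : μ → ℝ) :
    lineValue K₀ E Q B 1 - lineValue K₀ E Q B 0 = B ⬝ᵥ (((blockProp (K₀ + E) Q)⁻¹ - (blockProp K₀ Q)⁻¹) *ᵥ B) := by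
  rw [lineValue_apply, lineValue_apply, lineK_one, lineK_zero, sub_mulVec, dotProduct_sub]

/-- **(E1) FOR FORMS** (file 107's `lineVal_one_sub_zero_eq_integral`): `⟨B, (P₁⁻¹ − P₀⁻¹) B⟩ = ∫₀¹ ⟨H_τ B, E H_τ B⟩ dτ`. [folklore] -/
theorem lineValue_one_sub_zero_eq_integral (h0 : K₀.PosDef) (h1 : (K₀ + E).PosDef) (hQ : Function.Injective Q.vecMul) (B : μ → ℝ) :
    B ⬝ᵥ (((blockProp (K₀ + E) Q)⁻¹ - (blockProp K₀ Q)⁻¹) *ᵥ B) = ∫ τ in (0:ℝ)..1, qf E (lineMin K₀ E Q B τ) := by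
  have h := lineVal_one_sub_zero_eq_integral (lineMin_mem h0 h1 hQ B) (lineMin_isMinOn h0 h1 hQ B)
  rw [lineVal_eq h0 h1 hQ B ⟨zero_le_one, le_refl _⟩, lineVal_eq h0 h1 hQ B ⟨le_refl _, zero_le_one⟩, lineValue_one_sub_zero,
    defect_qf_line] at h
  exact h

end Selection

/-! ### §3 Operator concavity of the value form `K ↦ (Q K⁻¹ Qᵀ)⁻¹` (Ando-type, by the variational characterisation) -/

section Concavity

variable {K₀ K₁ : Matrix ν ν ℝ} {Q : Matrix μ ν ℝ}

omit [Fintype ν] [DecidableEq ν] in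
/-- a convex combination of two positive forms with `a + b = 1`, `a, b ≥ 0` is positive. [folklore] -/
theorem convex_posDef (h0 : K₀.PosDef) (h1 : K₁.PosDef) {a b : ℝ} (ha : 0 ≤ a) (hb : 0 ≤ b) (hab : a + b = 1) :
    (a • K₀ + b • K₁).PosDef := by
  rcases eq_or_lt_of_le ha with h | h
  · have hb1 : b = 1 := by linarith
    rw [← h, hb1, zero_smul, zero_add, one_smul]; exact h1
  · exact Matrix.PosDef.add_posSemidef (h0.smul h) (h1.posSemidef.smul hb)

/-- **CONCAVITY OF THE VALUE, quadratic-form version**: `a⟨B,P(K₀)⁻¹B⟩ + b⟨B,P(K₁)⁻¹B⟩ ≤ ⟨B, P(aK₀ + bK₁)⁻¹B⟩` — the minimum over the fibre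
of `a·qf K₀ + b·qf K₁` is at least the sum of the minima. [folklore] -/
theorem value_concave_qf (h0 : K₀.PosDef) (h1 : K₁.PosDef) (hQ : Function.Injective Q.vecMul) {a b : ℝ} (ha : 0 ≤ a) (hb : 0 ≤ b)
    (hab : a + b = 1) (B : μ → ℝ) :
    a * (B ⬝ᵥ ((blockProp K₀ Q)⁻¹ *ᵥ B)) + b * (B ⬝ᵥ ((blockProp K₁ Q)⁻¹ *ᵥ B)) ≤
      B ⬝ᵥ ((blockProp (a • K₀ + b • K₁) Q)⁻¹ *ᵥ B) := by
  have hc := convex_posDef h0 h1 ha hb hab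
  set Hc := minMap (a • K₀ + b • K₁) Q *ᵥ B with hHc
  have hmem : Hc ∈ fibre Q B := minMap_mulVec_mem_fibre hc hQ B
  rw [← qf_minMap h0 hQ, ← qf_minMap h1 hQ, ← qf_minMap hc hQ, qf_add_form, qf_smul_form, qf_smul_form]
  have e0 := (isMinOn_iff.mp (isMinOn_qf_minMap h0 hQ B)) Hc hmem
  have e1 := (isMinOn_iff.mp (isMinOn_qf_minMap h1 hQ B)) Hc hmem
  exact add_le_add (mul_le_mul_of_nonneg_left e0 ha) (mul_le_mul_of_nonneg_left e1 hb)

omit [Fintype μ] [DecidableEq μ] in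
/-- the block propagator of a symmetric form is symmetric. [folklore] -/
theorem blockProp_transpose {K : Matrix ν ν ℝ} (hKs : Kᵀ = K) (Q : Matrix μ ν ℝ) : (blockProp K Q)ᵀ = blockProp K Q := by
  rw [blockProp_eq, transpose_mul, transpose_mul, transpose_transpose, transpose_nonsing_inv, hKs, Matrix.mul_assoc]

/-- the value form of a symmetric form is symmetric. [folklore] -/
theorem blockPropInv_transpose {K : Matrix ν ν ℝ} (hKs : Kᵀ = K) (Q : Matrix μ ν ℝ) : ((blockProp K Q)⁻¹)ᵀ = (blockProp K Q)⁻¹ := by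
  rw [transpose_nonsing_inv, blockProp_transpose hKs]

/-- **OPERATOR CONCAVITY OF THE VALUE FORM** (Ando-type): for positive `K₀`, `K₁`, `Q` with independent rows, `a, b ≥ 0`, `a + b = 1`,
`(Q (aK₀ + bK₁)⁻¹ Qᵀ)⁻¹ − (a (QK₀⁻¹Qᵀ)⁻¹ + b (QK₁⁻¹Qᵀ)⁻¹) ⪰ 0`. [folklore] -/
theorem blockPropInv_concave (h0 : K₀.PosDef) (h1 : K₁.PosDef) (hQ : Function.Injective Q.vecMul) {a b : ℝ} (ha : 0 ≤ a) (hb : 0 ≤ b)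
    (hab : a + b = 1) :
    ((blockProp (a • K₀ + b • K₁) Q)⁻¹ - (a • (blockProp K₀ Q)⁻¹ + b • (blockProp K₁ Q)⁻¹)).PosSemidef := by
  have hc := convex_posDef h0 h1 ha hb hab
  apply posSemidef_of_qf_nonneg
  · rw [transpose_sub, transpose_add, transpose_smul, transpose_smul, blockPropInv_transpose (transpose_eq_of_posDef hc),
      blockPropInv_transpose (transpose_eq_of_posDef h0), blockPropInv_transpose (transpose_eq_of_posDef h1)]
  · intro B
    have h := value_concave_qf h0 h1 hQ ha hb hab B
    rw [sub_mulVec, dotProduct_sub, add_mulVec, dotProduct_add, smul_mulVec, smul_mulVec, dotProduct_smul, dotProduct_smul, smul_eq_mul,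
      smul_eq_mul]
    linarith

end Concavity

/-! ### §4 The exact (E4) expansion between any two parameters, the remainder `q` named, non-negative and uniformly bounded -/

section Expansion

variable {K₀ E : Matrix ν ν ℝ} {Q : Matrix μ ν ℝ}

/-- THE (E4) REMAINDER FORM `q(τ, σ) := ⟨E U_τB, G_σ (E U_τB)⟩` — constrained propagator at `σ`, first variation of the defect at `U_τ B`
(lens 2's `q(τ) = ⟨P d𝔇(U_τ), H_τ^{−1} P d𝔇(U_τ)⟩` is the diagonal `σ = τ`). [folklore] -/
def qrem (K₀ E : Matrix ν ν ℝ) (Q : Matrix μ ν ℝ) (B : μ → ℝ) (τ σ : ℝ) : ℝ :=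
  (E *ᵥ lineMin K₀ E Q B τ) ⬝ᵥ (constrProp (lineK K₀ E σ) Q *ᵥ (E *ᵥ lineMin K₀ E Q B τ))

/-- unfolding. [folklore] -/
@[simp] theorem qrem_apply (B : μ → ℝ) (τ σ : ℝ) :
    qrem K₀ E Q B τ σ = (E *ᵥ lineMin K₀ E Q B τ) ⬝ᵥ (constrProp (lineK K₀ E σ) Q *ᵥ (E *ᵥ lineMin K₀ E Q B τ)) := rfl

/-- **THE EXACT (E4) EXPANSION**: for all `τ, σ ∈ [0,1]`, `g(σ) = g(τ) + (σ−τ)·⟨U_τB, E U_τB⟩ − (σ−τ)²·q(τ,σ)` — file 108's (E2) at the pair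
`(K_τ, K_σ)`; the FIRST-ORDER coefficient is the defect at `U_τ` (Hellmann–Feynman), the remainder is `(σ−τ)²` times a non-negative form.
[folklore] -/
theorem lineValue_expand (h0 : K₀.PosDef) (h1 : (K₀ + E).PosDef) (hQ : Function.Injective Q.vecMul) (B : μ → ℝ) {τ σ : ℝ}
    (hτ : τ ∈ Icc (0:ℝ) 1) (hσ : σ ∈ Icc (0:ℝ) 1) :
    lineValue K₀ E Q B σ = lineValue K₀ E Q B τ + (σ - τ) * qf E (lineMin K₀ E Q B τ) - (σ - τ) ^ 2 * qrem K₀ E Q B τ σ := by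
  have hτ' := lineK_posDef h0 h1 hτ
  have hσ' := lineK_posDef h0 h1 hσ
  have h := bracket_forms_eq_sub_green hτ' hσ' hQ B
  rw [lineK_sub, qf_smul_form, smul_mulVec, mulVec_smul, smul_dotProduct, dotProduct_smul, smul_eq_mul, smul_eq_mul,
    sub_mulVec, dotProduct_sub] at h
  simp only [lineValue_apply, lineMin_apply, qrem_apply]
  rw [sub_eq_iff_eq_add'] at h
  rw [h]
  ring

/-- the (E4) remainder between two parameters, read as file 106's `R₂` for the pair `(A_τ, A_σ)`: `g(τ) + (σ−τ)𝔇(U_τ) − g(σ) = (σ−τ)² q(τ,σ)`.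
[folklore] -/
theorem remainder_two_points (h0 : K₀.PosDef) (h1 : (K₀ + E).PosDef) (hQ : Function.Injective Q.vecMul) (B : μ → ℝ) {τ σ : ℝ}
    (hτ : τ ∈ Icc (0:ℝ) 1) (hσ : σ ∈ Icc (0:ℝ) 1) :
    lineValue K₀ E Q B τ + (σ - τ) * qf E (lineMin K₀ E Q B τ) - lineValue K₀ E Q B σ = (σ - τ) ^ 2 * qrem K₀ E Q B τ σ := by
  rw [lineValue_expand h0 h1 hQ B hτ hσ]; ring

/-- `q(τ,σ) ≥ 0` (the constrained propagator is positive semidefinite, file 108). [folklore] -/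
theorem qrem_nonneg (h0 : K₀.PosDef) (h1 : (K₀ + E).PosDef) (hQ : Function.Injective Q.vecMul) (B : μ → ℝ) (τ : ℝ) {σ : ℝ}
    (hσ : σ ∈ Icc (0:ℝ) 1) : 0 ≤ qrem K₀ E Q B τ σ :=
  green_form_nonneg (lineK_posDef h0 h1 hσ) hQ _

/-- `q(τ,σ) ≤ ⟨x, K_σ⁻¹ x⟩`, `x = E U_τB` (file 108's `G ⪯ K⁻¹`). [folklore] -/
theorem qrem_le_inv_form (h0 : K₀.PosDef) (h1 : (K₀ + E).PosDef) (hQ : Function.Injective Q.vecMul) (B : μ → ℝ) (τ : ℝ) {σ : ℝ}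
    (hσ : σ ∈ Icc (0:ℝ) 1) :
    qrem K₀ E Q B τ σ ≤ (E *ᵥ lineMin K₀ E Q B τ) ⬝ᵥ ((lineK K₀ E σ)⁻¹ *ᵥ (E *ᵥ lineMin K₀ E Q B τ)) :=
  green_form_le_inv (lineK_posDef h0 h1 hσ) hQ _

variable {K : Matrix ν ν ℝ}

omit [Fintype μ] [DecidableEq μ] in
/-- COMPLETING THE SQUARE: `2⟨x, y⟩ − ⟨y, K y⟩ ≤ ⟨x, K⁻¹ x⟩` for `K ≻ 0` (the difference is `⟨y − K⁻¹x, K(y − K⁻¹x)⟩ ≥ 0`) — the inverse form is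
a SUPREMUM of functions affine in `K`. [folklore] -/
theorem two_mul_dot_sub_qf_le_inv_form (hK : K.PosDef) (x y : ν → ℝ) : 2 * (x ⬝ᵥ y) - y ⬝ᵥ (K *ᵥ y) ≤ x ⬝ᵥ (K⁻¹ *ᵥ x) := by
  have hKs := transpose_eq_of_posDef hK
  have hu := isUnit_det_of_posDef hK
  set z := K⁻¹ *ᵥ x with hz
  have hKz : K *ᵥ z = x := by rw [hz, mulVec_mulVec, mul_nonsing_inv K hu, one_mulVec]
  have hpos := qf_nonneg_of_posSemidef hK.posSemidef (y - z)
  have hexp : (y - z) ⬝ᵥ (K *ᵥ (y - z)) = y ⬝ᵥ (K *ᵥ y) - 2 * (x ⬝ᵥ y) + x ⬝ᵥ (K⁻¹ *ᵥ x) := by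
    have e1 : z ⬝ᵥ (K *ᵥ y) = y ⬝ᵥ (K *ᵥ z) := dot_mulVec_comm hKs z y
    rw [mulVec_sub, dotProduct_sub, sub_dotProduct, sub_dotProduct, e1, hKz, ← hz, dotProduct_comm y x, dotProduct_comm z x]
    ring
  linarith

omit [Fintype μ] [DecidableEq μ] in
/-- and EQUALITY at `y = K⁻¹x`: `⟨x, K⁻¹x⟩ = 2⟨x, K⁻¹x⟩ − ⟨K⁻¹x, K K⁻¹x⟩`. [folklore] -/
theorem inv_form_eq_sup (hK : K.PosDef) (x : ν → ℝ) :
    x ⬝ᵥ (K⁻¹ *ᵥ x) = 2 * (x ⬝ᵥ (K⁻¹ *ᵥ x)) - (K⁻¹ *ᵥ x) ⬝ᵥ (K *ᵥ (K⁻¹ *ᵥ x)) := by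
  rw [mulVec_mulVec, mul_nonsing_inv K (isUnit_det_of_posDef hK), one_mulVec, dotProduct_comm (K⁻¹ *ᵥ x) x]
  ring

omit [Fintype μ] [DecidableEq μ] in
/-- **THE INVERSE IS OPERATOR-CONVEX ALONG THE SEGMENT** (variationally, no spectral theory): for `σ ∈ [0,1]`,
`⟨x, K_σ⁻¹ x⟩ ≤ (1−σ)·⟨x, K₀⁻¹ x⟩ + σ·⟨x, (K₀+E)⁻¹ x⟩`. [folklore] -/
theorem inv_lineK_form_le (h0 : K₀.PosDef) (h1 : (K₀ + E).PosDef) {σ : ℝ} (hσ : σ ∈ Icc (0:ℝ) 1) (x : ν → ℝ) :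
    x ⬝ᵥ ((lineK K₀ E σ)⁻¹ *ᵥ x) ≤ (1 - σ) * (x ⬝ᵥ (K₀⁻¹ *ᵥ x)) + σ * (x ⬝ᵥ ((K₀ + E)⁻¹ *ᵥ x)) := by
  have hσ' := lineK_posDef h0 h1 hσ
  set z := (lineK K₀ E σ)⁻¹ *ᵥ x with hz
  have hsplit : z ⬝ᵥ (lineK K₀ E σ *ᵥ z) = (1 - σ) * (z ⬝ᵥ (K₀ *ᵥ z)) + σ * (z ⬝ᵥ ((K₀ + E) *ᵥ z)) := by
    rw [lineK_convex, add_mulVec, dotProduct_add, smul_mulVec, smul_mulVec, dotProduct_smul, dotProduct_smul, smul_eq_mul, smul_eq_mul]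
  have heq := inv_form_eq_sup hσ' x
  rw [← hz] at heq
  have a0 := two_mul_dot_sub_qf_le_inv_form h0 x z
  have a1 := two_mul_dot_sub_qf_le_inv_form h1 x z
  have hs0 : 0 ≤ 1 - σ := sub_nonneg.mpr hσ.2
  have hs1 : 0 ≤ σ := hσ.1
  -- ⟨x,K_σ⁻¹x⟩ = (1−σ)[2⟨x,z⟩ − ⟨z,K₀z⟩] + σ[2⟨x,z⟩ − ⟨z,K₁z⟩]
  have key : x ⬝ᵥ z = (1 - σ) * (2 * (x ⬝ᵥ z) - z ⬝ᵥ (K₀ *ᵥ z)) + σ * (2 * (x ⬝ᵥ z) - z ⬝ᵥ ((K₀ + E) *ᵥ z)) := by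
    linear_combination heq - hsplit
  rw [key]
  exact add_le_add (mul_le_mul_of_nonneg_left a0 hs0) (mul_le_mul_of_nonneg_left a1 hs1)

/-- hence **`q(τ,σ) ≤ ⟨x, K₀⁻¹x⟩ + ⟨x, (K₀+E)⁻¹x⟩`, `x = E U_τB`, UNIFORMLY IN `σ ∈ [0,1]`** — the bound that makes Hellmann–Feynman a
one-line limit. [folklore] -/
theorem qrem_le_const (h0 : K₀.PosDef) (h1 : (K₀ + E).PosDef) (hQ : Function.Injective Q.vecMul) (B : μ → ℝ) (τ : ℝ) {σ : ℝ}
    (hσ : σ ∈ Icc (0:ℝ) 1) :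
    qrem K₀ E Q B τ σ ≤ (E *ᵥ lineMin K₀ E Q B τ) ⬝ᵥ (K₀⁻¹ *ᵥ (E *ᵥ lineMin K₀ E Q B τ)) +
      (E *ᵥ lineMin K₀ E Q B τ) ⬝ᵥ ((K₀ + E)⁻¹ *ᵥ (E *ᵥ lineMin K₀ E Q B τ)) := by
  set x := E *ᵥ lineMin K₀ E Q B τ with hx
  have h1' := qrem_le_inv_form h0 h1 hQ B τ hσ
  have h2 := inv_lineK_form_le h0 h1 hσ x
  have p0 : 0 ≤ x ⬝ᵥ (K₀⁻¹ *ᵥ x) := qf_nonneg_of_posSemidef h0.inv.posSemidef x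
  have p1 : 0 ≤ x ⬝ᵥ ((K₀ + E)⁻¹ *ᵥ x) := qf_nonneg_of_posSemidef h1.inv.posSemidef x
  rw [← hx] at h1'
  have hs0 : 0 ≤ 1 - σ := sub_nonneg.mpr hσ.2
  nlinarith [hσ.1, hσ.2]

end Expansion

/-! ### §5 Hellmann–Feynman: `g′(τ) = ⟨U_τB, E U_τB⟩ = 𝔇(U_τ)` within `[0,1]` -/

section HellmannFeynman

variable {K₀ E : Matrix ν ν ℝ} {Q : Matrix μ ν ℝ}

/-- **HELLMANN–FEYNMAN FOR THE CONSTRAINED MINIMUM**: the value `g(τ) = ⟨B, P_τ⁻¹B⟩ = min_{QA=B} qf K_τ A` is differentiable within `[0,1]`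
at every `τ ∈ [0,1]` with derivative the defect at the minimiser, `⟨U_τB, E U_τB⟩` — (E1)'s «g′(τ) = 𝔇(U_τ)» as a theorem (the slope from
`τ` to `σ` differs from it by `−(σ−τ)q(τ,σ)`, §4). [folklore] -/
theorem hasDerivWithinAt_lineValue (h0 : K₀.PosDef) (h1 : (K₀ + E).PosDef) (hQ : Function.Injective Q.vecMul) (B : μ → ℝ) {τ : ℝ}
    (hτ : τ ∈ Icc (0:ℝ) 1) :
    HasDerivWithinAt (lineValue K₀ E Q B) (qf E (lineMin K₀ E Q B τ)) (Icc (0:ℝ) 1) τ := by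
  set x := E *ᵥ lineMin K₀ E Q B τ with hx
  set C := x ⬝ᵥ (K₀⁻¹ *ᵥ x) + x ⬝ᵥ ((K₀ + E)⁻¹ *ᵥ x) with hC
  have hC0 : 0 ≤ C :=
    add_nonneg (qf_nonneg_of_posSemidef h0.inv.posSemidef x) (qf_nonneg_of_posSemidef h1.inv.posSemidef x)
  rw [hasDerivWithinAt_iff_tendsto_slope]
  refine Metric.tendsto_nhdsWithin_nhds.mpr fun ε hε => ?_
  refine ⟨ε / (C + 1), by positivity, fun σ hσ hdist => ?_⟩
  have hσI : σ ∈ Icc (0:ℝ) 1 := hσ.1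
  have hne : σ ≠ τ := fun h => hσ.2 h
  have hne' : σ - τ ≠ 0 := sub_ne_zero.mpr hne
  have hexp := lineValue_expand h0 h1 hQ B hτ hσI
  have hslope : slope (lineValue K₀ E Q B) τ σ = qf E (lineMin K₀ E Q B τ) - (σ - τ) * qrem K₀ E Q B τ σ := by
    rw [slope_def_field, hexp]
    field_simp
    ring
  have hq0 := qrem_nonneg h0 h1 hQ B τ hσI
  have hqC : qrem K₀ E Q B τ σ ≤ C := by
    have := qrem_le_const h0 h1 hQ B τ hσI
    rw [← hx] at this
    exact this
  rw [hslope, Real.dist_eq]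
  rw [Real.dist_eq] at hdist
  have : |qf E (lineMin K₀ E Q B τ) - (σ - τ) * qrem K₀ E Q B τ σ - qf E (lineMin K₀ E Q B τ)| = |σ - τ| * qrem K₀ E Q B τ σ := by
    rw [sub_sub_cancel_left, abs_neg, abs_mul, abs_of_nonneg hq0]
  rw [this]
  have hC1 : 0 < C + 1 := by linarith
  calc |σ - τ| * qrem K₀ E Q B τ σ ≤ (ε / (C + 1)) * C :=
        mul_le_mul hdist.le hqC hq0 (by positivity)
    _ < ε := by
        rw [div_mul_eq_mul_div, div_lt_iff₀ hC1]
        nlinarith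

/-- the same at the endpoints in the bracket's letters: the RIGHT derivative of `g` at `0` is the defect at run A's minimiser `⟨H₀B, E H₀B⟩`,
the LEFT derivative at `1` is the defect at run B's minimiser `⟨H₁B, E H₁B⟩`. [folklore] -/
theorem hasDerivWithinAt_lineValue_endpoints (h0 : K₀.PosDef) (h1 : (K₀ + E).PosDef) (hQ : Function.Injective Q.vecMul) (B : μ → ℝ) :
    HasDerivWithinAt (lineValue K₀ E Q B) (qf E (minMap K₀ Q *ᵥ B)) (Icc (0:ℝ) 1) 0 ∧
      HasDerivWithinAt (lineValue K₀ E Q B) (qf E (minMap (K₀ + E) Q *ᵥ B)) (Icc (0:ℝ) 1) 1 := by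
  have h0' := hasDerivWithinAt_lineValue h0 h1 hQ B (τ := 0) ⟨le_refl _, zero_le_one⟩
  have h1' := hasDerivWithinAt_lineValue h0 h1 hQ B (τ := 1) ⟨zero_le_one, le_refl _⟩
  rw [lineMin_apply, lineK_zero] at h0'
  rw [lineMin_apply, lineK_one] at h1'
  exact ⟨h0', h1'⟩

end HellmannFeynman

end Summit.QuantumFields.BalabanUV.T4Continuum.NE7EJBracketPath

end
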